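import Summits.BirchSwinnertonDyer.Rank1Residual.F1Sign2.AnalyticLineTransferAtTwo
import Literature.NumberTheory.EllipticCurves.ModularJacobianModPMultiplicityOne
import Mathlib.NumberTheory.Padics.PadicNumbers
import Mathlib.LinearAlgebra.Matrix.Symmetric
import HarnessLib

/-!
# Cell `bsd-f1-sign2` — IMC lens (seat `-imc`, g3): COPY ⟷ CANONICAL LINE at a non-Gorenstein `𝔪 ∋ 2`
# — typed candidates `CopyAlignmentAtTwo` (IMC-H12⁺) and `MultiplicityTwoOnStratumAtTwo` (IMC-MULT2),
# plus the kernel-checked `𝔽₂` core of the mechanism «H12♯» (`vecMulVec_isSymm_iff_fin_two`).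

STATEMENTS ONLY (two `@[conjecture]` candidates = open obligations, nothing asserted; four support definitions WITH
bodies; two `decide`d `𝔽₂`-lemmas PROVED in-file; no named fact, no `sorry`).

TYPER FILING (seat `bsd-f1-sign2-ty` g3; CANDIDATES.md rows IMC-H12 / IMC-MULT2): bodies VERBATIM from the planner's sketch
`HOME/MEMO-imc-data/SketchG3-CopyAlignment-v1.lean` ea1c658bcd1f23cf (-imc g3 2026-08-27T20:04:19Z, MEMO-imc §10.24; lean rc 0 per -imc;
BC7 self-probe CLEAN ×2, `MEMO-imc-data/ProbeG3_BC7.txt`); the only edits are this header, the cell's filing conventions (the two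
candidates keep the `@[conjecture]` attribute the sketch already carries) and the bib key `Gross1990` (B. H. Gross, «A tameness criterion
for Galois representations associated to modular forms (mod p)», Duke Math. J. 61 (1990)) for the sketch's `Gross1990Tameness`.
REF2-PLACEMENT v13 (5febabf99e94ccd2) §1 / §1.2, delta 2026-08-27T20:20:51Z: `CopyAlignmentAtTwo` = IN-PRINT-ASSEMBLY (lever printed:
Emerton 2002, JAMS 15, §6 Lemma 6.6/(6.7) at prime level, length 4; Wiese 2007 Prop. 2.2 / Cor. 4.2; Kilford–Wiese 2008 Prop. 2.6;
unprinted: the `G⁰`-at-2 reading, copy ↔ line, composite level; grade new-combination; beyond-print: no separate row — it is the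
mechanism of IMC-SYMB on the ON stratum); `MultiplicityTwoOnStratumAtTwo` = OPEN IN PRINT, printed as a QUESTION (Kilford–Wiese 2008
Question 1.9, prime level; the `Γ₀(N)`, `N` odd transport is a variant); census instances in print as data (Kilford 2002 §4, Stein's
tables; v10 §6.1). REF1-AUDIT-v1 §34 (b1e61061cdbd263b, 2026-08-27T22:40:45Z; evidence `HOME/REF1-data/b31/`, 34 files: as-is rc 0, A1 probes +
guards G1–G8, BC7 CLEAN ×2 agreeing with -imc's probe, axioms of both decide-lemmas standard; two-engine job j292600, engine A = PARI
`msinit/mslattice/mshecke` REPRODUCES H12 at 431 (0/1 same copy), 503 (0/3), 2089 (1/6); §34b = engine A rerun j292690 + engine B (Sage) on 13 twist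
levels, pending): helpers CORRECT (meaningful for `f` a normalised eigenform; `⊤` at `f = 0`, excluded downstream by `IsNewformOf`); **MULT2
`MultiplicityTwoOnStratumAtTwo` SURVIVES as typed** (conjecture-grade = Kilford–Wiese Question 1.9 asserted on the `Γ₀(N)`-elliptic-`S₃` stratum;
scope (α): `IsOrdinaryAt` = GOOD ordinary ⇒ ODD level only; caveat (β): at `q² ∣ N` the full-`𝕋` `J₀(N)[𝔪]` counts `q`-OLD packages — under test in
§34b, repair if needed = restrict to the 2-new quotient or squarefree `N`); **CA `CopyAlignmentAtTwo` SURVIVES** (conjecture-grade with a theorem-grade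
mechanism at `r = 2` modulo (γ): the `J₁ → J₀` transport of Wiese's `M_big ≅ T̄` at composite `N` — in print at prime level only; the edge «`f₂` at another
`𝔪`» is impossible under the typing; tree `AlignedAtTwo` = -imc's unit-root convention ON the stratum, proved on paper; `finrank = 4` load-bearing, CA at
`r ≥ 3` not claimed — correct scoping); NEW (REF1): same-level quadratic-twist pairs `(E, E^χ)`, `χ` of conductor `m`, `m² ∣ N` (excluded from H12/P14 by
design; 24 ON-stratum groups at odd `N < 10⁴`) are a THEOREM sub-case — `twoTorsionCopy f = twoTorsionCopy (f ⊗ χ)` unconditionally via the Atkin–Li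
operator `R_χ ≡ R₀ = μ(m) (mod 2)`, and such pairs are always aligned, so both sides of the «iff» are TRUE there; answers to -imc's (1)–(5): (1) yes modulo
the named fact `IsNewform0.heckeEigenvalue_eq_coeff`, (2) impossible, (3) perfect + self-adjoint only, (4) functoriality only, (5) `r = 2` load-bearing
confirmed. «OK for -ty to file (d) statements-only, both `@[conjecture]`, docstrings carrying (α), (β), (γ) and the twist corollary» — done below.
PARTITION: none moved; beyond-print theorem: no.
bears_on: `stmt-BirchSwinnertonDyer-19099` via the IMC-SYMB(ON) line and the route `route-BirchSwinnertonDyer-AlignedTransportAtTwo`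
(crux C1 `MainConjectureTransportAlignedAtTwo`, whose alignment hypothesis these statements read on `J₀(N)[2]`).

Setting (MEMO-imc §10.20–§10.24). `N` odd, `E₁, E₂ / ℚ` of conductor `N`, no rational `2`-torsion, `E₁[2] ≅ E₂[2]`
with image `S₃` (common NON-Galois cubic field `F` of the two `u`-cubics), ON the Kilford stratum (`F ⊗ ℚ₂ ≅ ℚ₂³`,
i.e. `ρ̄(Frob₂) = 1`; then `E_i` is good ORDINARY at `2`). Let `𝕋 = 𝕋_ℤ(S₂(Γ₀(N)))` (tree: `HeckeRing0 N 2`),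
`f_i` the newforms, `I_i = Ann_𝕋(f_i)`, `𝔪 = I_1 + 2𝕋 = I_2 + 2𝕋` (residue field `𝔽₂`), `Λ = H₁(X₀(N), ℤ)`
(tree: `periodHomology N`), `J = J₀(N)(ℂ) = S₂^∨/Λ` (tree: `J0 N`). The COPY of `E_i[2]` in `J[2]` is
`½Λ[I_i]/Λ` (= `π_i^*E_i[2]` for the optimal curve; as a subgroup of `J` it depends only on `f_i`): `twoTorsionCopy f_i`.

Mechanism «H12♯» (ours; an ASSEMBLY of printed structure theorems + one linear-algebra observation). Write
`T̄ = 𝕋_𝔪/2`, `V = J[2]_𝔪`, `r` = multiplicity (`V[𝔪] ≅ ρ̄ ⊗ W`, `dim W = r`; Boston–Lenstra–Ribet), `M_big ⊂ V` the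
multiplicative (connected) part at `2`. PRINTED INPUTS: (W1) `M_big ≅ T̄` free of rank one and `V/M_big ≅ T̄^∨`
(Wiese, Algebra Number Theory 1 (2007) 67–85 = arXiv:math/0612318, Prop. 2.2 + Cor. 2.3, Situation 1.1 (2): «p any
prime», `p ∤ N`, `𝔪` ordinary, `ρ_𝔪` irreducible; stated for `J₁(N)`, transported to `J₀(N)` by Kilford–Wiese,
Exp. Math. 17 (2008) = arXiv:math/0612317, Prop. 2.6); (W2) `d = 2r − 2` for the Gorenstein defect, so
`dim soc T̄ = 2r − 1` (Kilford–Wiese Cor. 1.6 / 2.5); (W3) the `w_N`-modified Weil pairing on `J[2]` is perfect,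
`G_ℚ`-invariant and makes every `T ∈ 𝕋` self-adjoint (Gross, Duke 61 (1990) p. 485; Kilford–Wiese proof of Prop. 2.1),
and at `p = 2` it is SYMMETRIC (values in `μ₂`). OBSERVATION (ours): for `τ ∈ soc T̄`, multiplication by `τ` factors as
`V/𝔪V ≅ ρ̄ ⊗ W^* → V[𝔪] ≅ ρ̄ ⊗ W`, `= 1_ρ̄ ⊗ t_τ` (Schur, `End_G ρ̄ = 𝔽₂`), and (W3) forces the bilinear form
`c_τ(u, u') = ⟨u, t_τ u'⟩` on `W^*` to be SYMMETRIC; faithfulness gives `soc T̄ ↪ Sym²(W^*)^∨`, an equality when `r = 2`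
(both of dimension `3`, by (W2)). Consequently `M = M_big ∩ V[𝔪] = soc T̄ · m₀` is, in bases adapted to the
(rank-two) image `m̄₀` of the generator, the space of SYMMETRIC `2 × 2` matrices inside `ρ̄ ⊗ W ≅ M₂(𝔽₂)`, while the
copy `ρ̄ ⊗ w` is the set of rank-≤ 1 matrices `a·wᵀ`. The kernel-checked lemma below says `a·wᵀ` is symmetric iff
`a ∈ {0, w}`: every copy meets the multiplicative part in EXACTLY ONE LINE, the line is `w·wᵀ`, distinct copies have
distinct lines, no copy is multiplicative. For a modular curve `E_i` the canonical subgroup `C_i = E_i[2]⁰` maps into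
`M`, so its image IS that line: ALIGNED AT 2 ⟺ SAME COPY (`CopyAlignmentAtTwo`), given `r = 2`
(`MultiplicityTwoOnStratumAtTwo` = Kilford–Wiese Question 1.9 transported to `Γ₀(N)`, `N` odd composite allowed:
«All of our 384 examples have Gorenstein defect equal to 2 and hence their multiplicity is 2», KW §1.2). For `r ≥ 3`
the same computation gives `M = {a₁⊗φ₁ + a₂⊗φ₂ : φ₁(u₂) = φ₂(u₁)}`: copies `ρ̄ ⊗ w` with `w|_{U₀} = 0` lie INSIDE
`M` and distinct copies can share a line — the hypothesis `r = 2` is load-bearing for «aligned ⇒ same copy».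

Census / falsifier (BC5): H12 census kit j287111 (10/10 ON-stratum `S₃` levels: same copy ⟺ aligned, pairwise
intersections of copies of dimension 0 or 2 only) and P14 kit j287465 (54 levels `N ≤ 8000`, 209 curves) — MEMO-imc
§10.22/§10.24. STATEMENTS ONLY below (two `@[conjecture]` Props, four definitions with bodies, one `decide`d lemma);
nothing is asserted as a theorem about curves. PARTITION: none moved.
-/

noncomputable section

open scoped Classical MatrixGroups ModularForm
open CongruenceSubgroup Polynomial
open Literature.NumberTheory.EllipticCurves Literature.NumberTheory.EllipticCurves.ModularForms
open Literature.NumberTheory.EllipticCurves.Greenberg1999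
open IsDedekindDomain NumberField

namespace Summit.BirchSwinnertonDyer.Rank1Residual.F1Sign2

section Copies

variable {N : ℕ} [NeZero N]

/-- The annihilator `I_f = Ann_𝕋(f) = {t ∈ 𝕋_ℤ : t f = 0}` of a cusp form in the full Hecke ring
`𝕋_ℤ = ℤ[T_p : p prime] ⊆ End(S₂(Γ₀(N)))`; for a normalised eigenform with integer eigenvalues this is the
kernel of its eigencharacter `𝕋_ℤ → ℤ` (Darmon–Diamond–Taylor §1.3, §4.1). A DEFINITION (REF1 §34: meaningful for `f` a normalised
eigenform; `⊤` at `f = 0`). [folklore] -/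
def heckeAnnihilator (f : CuspForm (Gamma0 N) 2) : Ideal (HeckeRing0 N 2) where
  carrier := {t | HeckeRing0.toEnd N 2 t f = 0}
  zero_mem' := by
    simp only [Set.mem_setOf_eq, map_zero, LinearMap.zero_apply]
  add_mem' := by
    intro s t hs ht
    simp only [Set.mem_setOf_eq] at hs ht ⊢
    rw [map_add, LinearMap.add_apply, hs, ht, add_zero]
  smul_mem' := by
    intro c t ht
    simp only [Set.mem_setOf_eq, smul_eq_mul] at ht ⊢
    rw [map_mul, Module.End.mul_apply, ht, map_zero]

/-- `Λ[I_f] = {x ∈ H₁(X₀(N), ℤ) : I_f · x = 0}`, the `f`-isotypic sublattice of the period homology (for the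
newform of an elliptic curve: the rank-two lattice `H₁(X₀(N), ℤ)[I_f]`, the period lattice of the OPTIMAL curve
up to the Manin constant; Cremona, Algorithms §2.6–2.8). A DEFINITION. [folklore] -/
def isotypicPeriodSublattice (f : CuspForm (Gamma0 N) 2) : Set (periodHomology N) :=
  {x | ∀ t ∈ heckeAnnihilator f, t • (x : Module.Dual ℂ (CuspForm (Gamma0 N) 2)) = 0}

/-- The COPY of `E_f[2]` inside `J₀(N)(ℂ)[2]`: the image of `Λ[I_f]` under `λ ↦ [½λ]`
(`= ½Λ[I_f]/Λ = π^*E[2]` for the optimal curve `E` of `f`; a `2`-dimensional `𝔽₂`-subspace of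
`J₀(N)[2] ≅ Λ/2Λ` since `Λ[I_f]` is saturated). A DEFINITION. [folklore] -/
def twoTorsionCopy (f : CuspForm (Gamma0 N) 2) : Set (J0 N) :=
  J0.divMap N 2 '' isotypicPeriodSublattice f

/-- The mod-`2` ideal `𝔪_f = I_f + 2𝕋_ℤ` of `f` (maximal with residue field `𝔽₂` when `f` has integer
eigenvalues; two such forms are congruent mod `2` — all `T_p`, `U_p` eigenvalues — iff their `𝔪`'s agree;
REF1 §34: `⊤` at `f = 0`; for a newform `𝕋/𝔪_f ≅ 𝔽₂` modulo the named fact `IsNewform0.heckeEigenvalue_eq_coeff`).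
A DEFINITION. [folklore] -/
def modTwoHeckeIdeal (f : CuspForm (Gamma0 N) 2) : Ideal (HeckeRing0 N 2) :=
  heckeAnnihilator f ⊔ Ideal.span {(2 : HeckeRing0 N 2)}

end Copies

/-- **Candidate `MultiplicityTwoOnStratumAtTwo` (IMC-MULT2; Kilford–Wiese Question 1.9 on `Γ₀(N)`, `N` odd).**
`E / ℚ` with no rational `2`-torsion and `Δ_E ∉ ℚ^{×2}` (`ρ̄ = E[2]` has image `S₃`, absolutely irreducible),
`f` its newform of level `N`, `E` good ordinary at `2` and ON the Kilford stratum (the `u`-cubic splits over `ℚ₂`,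
`ρ̄(Frob₂) = 1`): then `dim_{𝕋/𝔪} J₀(N)[𝔪_f] = 4`, i.e. the multiplicity of `ρ̄` on `J₀(N)[2]` is EXACTLY `2`.
In print: `r ≥ 2` (Wiese 2007 Cor. 4.4/4.5 with Kilford–Wiese 2008 Prop. 2.6; at `p = 2` under the printed
hypothesis «a Katz cusp form over `𝔽₂` of weight 1 on `Γ₁(N)` exists which gives rise to `ρ_𝔪`», KW Thm. 1.3 (b));
`r = 2` is ASKED (KW Question 1.9, prime level, weight `p`: «is the multiplicity … always equal to 2?»; 384/384
examples) — ANSWERED «yes» for ODD `p` (fold 2026-08-29, att-p3 g21 / REF2 v54 §12): [cite: CalegariGeraghty2018, Thm. 3.25, Rem. 3.26, Rem. 3.29]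
(«if ρ̄ is unramified at p and ρ̄(Frob_p) is scalar, then J₁(N*)[𝔪] ≃ ρ̄ ⊕ ρ̄, that is, 𝔪 has multiplicity two … our contribution … is to show that
the multiplicity is exactly two in the scalar case»; `p ≥ 3`, `ρ̄` absolutely irreducible modular, `N = N(ρ̄)`; `J_H(N*)` for `p ≠ 3` / `ρ̄` not induced
from `ℚ(√−3)`); at `p = 2`: [cite: CalegariGeraghty2018, Rem. 3.31] «should also apply in principle» through Snowden's crystalline-ordinary quotient
([cite: Snowden2018SingularitiesOrdinary, §4]) «assuming that ρ̄ is not induced from a quadratic extension … this will require that ρ̄ is not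
dihedral» — the cell's `ρ̄ = W[2]` with image `S₃ = D₃` IS dihedral, so THIS statement (p = 2, `Γ₀(N)`, the Kilford stratum) stays OPEN in print;
mechanism [cite: CalegariGeraghty2018, Thm. 3.24]: the framed ordinary deformation ring of the trivial local representation is Cohen–Macaulay,
non-Gorenstein with 3-generated canonical module = Emerton's `T⁰_𝔪/2` at `N = 431`, whence `r = (3+1)/2 = 2` (att-p5/att-p3's socle rows `s = 3`
147/147 + 127/127 are that one number). Why it might fail: composite odd `N` with several oldform-free congruent classes could push `r ≥ 3`
(no printed bound); census so far: pairwise copy-intersections of dimension `0` or `2` only (j287111, j287465).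
REF1-AUDIT §34: SURVIVES as typed, conjecture-grade (an open QUESTION made a typed conjecture; beyond-print theorem: no).
SCOPE (α): `IsOrdinaryAt W 2` is GOOD ordinary, so the statement lives at ODD level `N` only. CAVEAT (β): the statement is over the
FULL `J₀(N)` and the FULL Hecke ring `𝕋` (all `T_n`, incl. `U_q`): at non-squarefree odd `N`, `J₀(N)[𝔪_f]` contains the `𝔪`-torsion of
`q`-OLD packages `g` of level `N/q` with `q ∣ N/q` and `ρ̄_g ≅ ρ̄_f`, so «`= 4`» can fail by old contributions even when the NEW multiplicity is
`2` (D-imc-10: 431, 503 prime, `d_full = 4` ✓; REF1 job j292600/j292690 reports `d_full` at 3159, 3807, 4825, 7725, … in §34b — if some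
`d_full ≥ 6` is stable, the repair is the 2-new quotient / anemic-new `𝕋` or squarefree `N`).
[cite: KilfordWiese2008, Question 1.9, Thm. 1.3, Cor. 1.6, Prop. 2.6] [cite: Wiese2007Multiplicities, Cor. 4.4] -/
@[conjecture] def MultiplicityTwoOnStratumAtTwo : Prop :=
  ∀ (W : WeierstrassCurve ℚ) [W.IsElliptic] [W.IsGloballyMinimal],
    (∀ x : ℚ, ¬ HasRationalTwoTorsionX W x) → ¬ IsSquare W.Δ →
    IsOrdinaryAt W 2 → ((twoDivisionUCubic W).map (algebraMap ℚ ℚ_[2])).Splits →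
    ∀ ⦃N : ℕ⦄ [NeZero N] (f : CuspForm (Gamma0 N) 2), IsNewformOf W f →
      Module.finrank (HeckeRing0 N 2 ⧸ modTwoHeckeIdeal f)
        (Submodule.torsionBySet (HeckeRing0 N 2) (J0 N) (modTwoHeckeIdeal f)) = 4

/-- **`MultiplicityTwoAtLevelAtTwo` (IMC-MULT2 at an arbitrary ODD level `L`; the binder `hM2L` of the C1 22296 composition files, VERBATIM).**
For every odd level `L`, every curve `W` on the cell's Kilford stratum (good ordinary at `2`, no rational `2`-torsion, `Δ_W ∉ ℚ^{×2}`,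
`OnKilfordStratumAtTwo W`) and every ideal `𝔪 ⊂ 𝕋 = HeckeRing0 L 2` of index `2` carrying `W`'s eigen-character away from `L`
(`T_p − a_p(W) ∈ 𝔪` for all primes `p ∤ L`): `dim_{𝕋/𝔪} J₀(L)[𝔪] = 4`, i.e. the multiplicity of `ρ̄ = W[2]` on `J₀(L)[𝔪]` is EXACTLY `2`.
At `L = N_W` this is `MultiplicityTwoOnStratumAtTwo` above read through `𝔪 = modTwoHeckeIdeal f`; at `L = lcm(N_{W₁}, N_{W₂})` or `L = M·q` it is the
level-generic sentence the cross-level kernel-letter route consumes — the hypothesis `hM2L` of p719272 §1 = p723742 = p726943 = p727366 (typed there inline),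
NAMED here at bsd-line-att-p5 g22's ask (INBOX 2026-08-29T15:09:57Z) so that LINE v31's first ∀-stub is citable BY NAME; typer -ty g18, body byte-identical to
the binder.  Status in print: `r ≥ 2` [cite: Wiese2007Multiplicities, Cor. 4.2, Cor. 4.4] (with [cite: KilfordWiese2008, Thm. 1.3, Cor. 1.6, Prop. 2.6]); `r = 2`
ASKED at prime level [cite: KilfordWiese2008, Question 1.9] — ANSWERED «yes» for ODD `p` [cite: CalegariGeraghty2018, Thm. 3.25, Rem. 3.26, Rem. 3.29], at `p = 2`
expected only for NON-dihedral `ρ̄` [cite: CalegariGeraghty2018, Rem. 3.31] (the `S₃ = D₃` stratum is dihedral: OPEN in print); NON-MINIMAL odd level (att-p3 g21,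
REF2 v54 §12): for odd `p` multiplicity survives «trivial primes» on `J₀` (Diamond 1997 / BKM 2021 Thm. 5.2 shape), so the `p = 2` analogue predicts `d = 4` at scalar
level raising `L = M·q`, `ρ̄(Frob_q) = 1` — covered by att-p5 g19's SOCLE census at `17671 = 41·431` (`d = 4`); censuses att-p3 g20 (incl. exotic ideals) and
att-p5 g19 147/147 + att-p3 g20 127/127.  Conjecture-grade (`@[conjecture]`: an open QUESTION made a typed hypothesis); beyond-print theorem: no. -/
@[conjecture] def MultiplicityTwoAtLevelAtTwo : Prop :=
  ∀ (L : ℕ) [NeZero L], ¬ 2 ∣ L →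
    ∀ (W : WeierstrassCurve ℚ) [W.IsElliptic] [W.IsGloballyMinimal], IsOrdinaryAt W 2 →
      (∀ x : ℚ, ¬ HasRationalTwoTorsionX W x) → ¬ IsSquare W.Δ → OnKilfordStratumAtTwo W →
      ∀ (𝔪 : Ideal (HeckeRing0 L 2)), Nat.card (HeckeRing0 L 2 ⧸ 𝔪) = 2 →
        (∀ (p : ℕ) (hp : p.Prime), ¬ p ∣ L → HeckeRing0.T L 2 p hp - ((W.frobeniusTrace p : ℤ) : HeckeRing0 L 2) ∈ 𝔪) →
        Module.finrank (HeckeRing0 L 2 ⧸ 𝔪) (Submodule.torsionBySet (HeckeRing0 L 2) (J0 L) 𝔪) = 4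

/-- **Candidate `CopyAlignmentAtTwo` (IMC-H12⁺; the typed shadow of «H12♯»).** `E₁, E₂ / ℚ` with no rational
`2`-torsion, `Δ_{E₁} ∉ ℚ^{×2}`, a common cubic number field `F ∋ e₁, e₂` of roots of the two `u`-cubics (so
`E₁[2] ≅ E₂[2]` with image `S₃`, by the unique isomorphism matching `σe₁ ↔ σe₂`), `E₁` good ordinary at `2` and ON
the Kilford stratum, newforms `f₁, f₂` of the SAME level `N`, and multiplicity two at `𝔪 = 𝔪_{f₁}`
(`dim J₀(N)[𝔪] = 4`). THEN: the copies of `E₁[2]` and `E₂[2]` in `J₀(N)[2]` COINCIDE iff the identification is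
ALIGNED AT `2` (the canonical subgroups `C_{E_i,2} = E_i[2]⁰` correspond). Mechanism: module docstring («H12♯»:
the multiplicative part of `J₀(N)[𝔪]` at `2` is the space of symmetric matrices in `ρ̄ ⊗ W ≅ M₂(𝔽₂)`; lemma
`vecMulVec_isSymm_iff_fin_two`). In print: the inputs (Wiese 2007 Prop. 2.2/Cor. 2.3, Kilford–Wiese 2008
Prop. 2.6/Cor. 2.5, Gross 1990 p. 485, Boston–Lenstra–Ribet 1991); the statement and the symmetric-socle
observation are, as far as searched (MEMO-imc §10.24: corpus fts+vec and galaxy), NOT in print. Why it might fail: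
a hidden use of `Aut ρ̄ = 1` / residue field `𝔽₂` (fails for `C₃`-image, excluded by `¬ IsSquare Δ`), or the
`J₁ → J₀` transport of Wiese's sequence at composite `N` (KW Prop. 2.6 transports `J[𝔪]`, not the whole sequence).
Census (BC5): j287111 10/10 levels, j287465 (P14).
REF1-AUDIT §34: SURVIVES — conjecture-grade with a theorem-grade mechanism at `r = 2` MODULO (γ); non-vacuous in both directions (2089 d1 ~ e1:
aligned, same copy; 431 a1, b1: misaligned, distinct copies, `d_full = 4`). SCOPE (α): odd level only (`IsOrdinaryAt W₁ 2` = good ordinary); of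
-imc's aligned same-level `S₃` pairs most sit at EVEN `N` (multiplicative at `2`, off this statement), the typed odd-level base today is 2089 (plus
3471, 4087, 7057, 7223, 7359, 7725 awaiting H12 copy data) — and the twist pairs below. The hypotheses are asymmetric on purpose: under them
`ℚ(e₁) = F = ℚ(e₂)`, `E₁[2] ≅ E₂[2]`, `𝔪_{f₁} = 𝔪_{f₂}` and `W₂` is good ordinary at `2` with split `u`-cubic as CONSEQUENCES (REF1 (2): the edge
«`f₂` at another `𝔪`» cannot occur). GAP (γ) = the unprinted, load-bearing step: (W1)–(W3) are Wiese 2007 for `J₁(N)` and Kilford–Wiese Prop. 2.6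
transports `J[𝔪]`, not the multiplicative filtration `M_big ≅ T̄`; the mechanism needs `M = soc(T̄)·m₀ ⊆ J₀(N)_𝔪[2]⁰` at COMPOSITE `N` — in print at
prime level only; CA becomes a beyond-print theorem once (γ) is located in print or proved. REMARK (REF1, theorem sub-case): for a same-level
quadratic-twist pair `f₂ = f₁ ⊗ χ` (`χ` primitive quadratic of conductor `m`, `m² ∣ N`; excluded from the H12/P14 census by its one-per-twist-orbit
design, 24 ON-stratum groups at odd `N < 10⁴`) one has `twoTorsionCopy f₁ = twoTorsionCopy f₂` UNCONDITIONALLY (Atkin–Li twisting operator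
`R_χ = Σ χ(a) α_a ≡ R₀ (mod 2)`, `R₀ f = μ(m) f`; no ordinarity, no `r = 2`) and such pairs are always ALIGNED (`e₂ = d e₁ − r`, `d` odd, `r` even,
same unit-root place) — both sides of the «iff» are true there (a consistency check; numerical two-engine cross-check = REF1 §34b).
[cite: Wiese2007Multiplicities, Prop. 2.2, Cor. 2.3]
[cite: KilfordWiese2008, Prop. 2.1 (proof), Prop. 2.6, Cor. 2.5] [cite: Gross1990, p. 485] -/
@[conjecture] def CopyAlignmentAtTwo : Prop :=
  ∀ (W₁ : WeierstrassCurve ℚ) [W₁.IsElliptic] [W₁.IsGloballyMinimal]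
    (W₂ : WeierstrassCurve ℚ) [W₂.IsElliptic] [W₂.IsGloballyMinimal],
    (∀ x : ℚ, ¬ HasRationalTwoTorsionX W₁ x) → (∀ x : ℚ, ¬ HasRationalTwoTorsionX W₂ x) →
    ¬ IsSquare W₁.Δ →
    ∀ (F : Type) [Field F] [NumberField F], Module.finrank ℚ F = 3 →
    ∀ e₁ e₂ : F, aeval e₁ (twoDivisionUCubic W₁) = 0 → aeval e₂ (twoDivisionUCubic W₂) = 0 →
    IsOrdinaryAt W₁ 2 → ((twoDivisionUCubic W₁).map (algebraMap ℚ ℚ_[2])).Splits →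
    ∀ ⦃N : ℕ⦄ [NeZero N] (f₁ f₂ : CuspForm (Gamma0 N) 2), IsNewformOf W₁ f₁ → IsNewformOf W₂ f₂ →
      Module.finrank (HeckeRing0 N 2 ⧸ modTwoHeckeIdeal f₁)
        (Submodule.torsionBySet (HeckeRing0 N 2) (J0 N) (modTwoHeckeIdeal f₁)) = 4 →
      (twoTorsionCopy f₁ = twoTorsionCopy f₂ ↔ AlignedAtTwo F e₁ e₂)

/-! ## The kernel-checked `𝔽₂` core of «H12♯»

In `ρ̄ ⊗ W ≅ M₂(𝔽₂)` (columns `a ∈ ρ̄`, rows `w ∈ W`), the copy `ρ̄ ⊗ w` is `{a·wᵀ}` and — by (W1)–(W3) and the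
symmetric-socle observation — the multiplicative part of `J₀(N)[𝔪]` is the space of symmetric matrices. -/

/-- A rank-one `2 × 2` matrix `a·wᵀ` over `𝔽₂` (`w ≠ 0`) is symmetric iff `a = 0` or `a = w`: each copy
`ρ̄ ⊗ w` meets the symmetric matrices in exactly the line `{0, w·wᵀ}`; hence distinct copies have distinct
multiplicative lines and no copy is entirely multiplicative («H12♯» for multiplicity two). [folklore] -/
theorem vecMulVec_isSymm_iff_fin_two :
    ∀ a w : Fin 2 → ZMod 2, w ≠ 0 → ((Matrix.vecMulVec a w).IsSymm ↔ (a = 0 ∨ a = w)) := by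
  decide

/-- The pairing form of «H12♯»: `a·wᵀ` is symmetric iff `a₀w₁ = a₁w₀`, i.e. the multiplicative hyperplane is the
kernel of the NONDEGENERATE (hyperbolic) form `Λ(a, w) = a₀w₁ + a₁w₀` on `ρ̄ × W` — the copy ↦ line map is the
`Λ`-orthogonality bijection `ℙ(W) → ℙ(ρ̄)`. [folklore] -/
theorem vecMulVec_isSymm_iff_hyperbolic :
    ∀ a w : Fin 2 → ZMod 2, (Matrix.vecMulVec a w).IsSymm ↔ a 0 * w 1 + a 1 * w 0 = 0 := by
  decide

end Summit.BirchSwinnertonDyer.Rank1Residual.F1Sign2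

end
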